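import Summits.ResolutionOfSingularities.ResolutionOfSingularities.Theorems.HilbertSamuelEliminationSigmaMaxModificationsCorridor3WLadderIsoRestartDefs
import Summits.ResolutionOfSingularities.ResolutionOfSingularities.Theorems.HilbertSamuelEliminationSigmaMaxModificationsCorridor3WLadderMovingIso
import Summits.ResolutionOfSingularities.ResolutionOfSingularities.Theorems.HilbertSamuelEliminationSigmaMaxModificationsCorridor3OriginAlongReaches
import HarnessLib

/-!
# [OURS · L1 W4.2] MODULE `Corridor3WLadderIsoRestart` — part 2/2: THE RESTART AT ISOLATED STAGES FOR LOCAL ORACLES from the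
# run-level Zariski localisation (crux chain w42, W4.2 DEAL D8 «ISO-RESTART AT LOCAL ORACLES», hand res-D-pv-060)

OURS (cell `res-hironaka`, slot W4.2, crux `stmt-ResolutionOfSingularities-18506` / conjunct `-19249`, skeleton `w_ladder` v6, idea-2's
card G `iso-recurrence-core`; `--supports … --as helper`, counted 0); NOT statements of the manuscript under review in the cell
[claim: Hironaka2017, status: under-review] nor of [CossartJannsenSaito2020]. AI plumbing, weaker than expert review.

## What is proved

* `Reindex.*` — the bookkeeping of a re-indexing `ψ` (`ψ 0 = 0`, steps `0/1`, incremented at every genuine step of a moving chain):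
  monotone, hits every value;
* **`isoOpenRestartM_oracleLocal_of_simulation`** — `LocalRunSimulationM p → IsoOpenRestartM OracleLocal p` (…MovingIsoDefs l.206):
  the ORIGIN DATA at the reached isolated stage `c 0` is res-type-071's `IsMaximalOrigin.exists_opens_pointed_of_iso`
  (…Corridor3OriginAlongReaches, p512798: an open `U ∋ x_s` of `X_s`, pointed, again a maximal origin for `(p, 3, ν)`); (S1) simulates the
  chain over `U`; the grades `3 ≤ ē` transfer along the open immersions (`Scheme.geomDirDim_eq_of_isOpenImmersion`), genuine steps by
  (S1)'s matching clause, isolation by 071's `Moving.Iso.of_isOpenImmersion_of_reaches`; the re-indexing hits every `U`-index (§1).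
* `isoOpenRestartM_oracleLocal` is therefore CONDITIONAL on (S1) only (res-L1-w42-plan-1 RULINGS v3.12-1 (A): S3 conditional; S1's proof
  = its own multi-session object).

[cite: CossartJannsenSaito2020, Thm. 1.2 (p. 5), Rem. 6.29 (1), Lemma 2.36, Def. 2.35]
-/

set_option linter.dupNamespace false

open CategoryTheory AlgebraicGeometry TopologicalSpace
open Summit.ResolutionOfSingularities.ResolutionOfSingularities.Theorems.CampaignW42
open Literature.AlgebraicGeometry.Resolution Literature.RingTheory.HilbertSamuel
open Literature.AlgebraicGeometry.CossartJannsenSaito2020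
open Summit.ResolutionOfSingularities.ResolutionOfSingularities.Theorems.SigmaMaxModificationsCorridor3
open Summit.ResolutionOfSingularities.ResolutionOfSingularities.Theorems.SigmaMaxModificationsCorridor3.Moving
open Summit.ResolutionOfSingularities.ResolutionOfSingularities.Theorems.SigmaMaxModificationsCorridor3.Helpers (QPointed)

universe u

/-! ## §1. Bookkeeping of the re-indexing `ψ` -/

namespace Summit.ResolutionOfSingularities.ResolutionOfSingularities.Cruxes.SigmaMaxModifications.IdeasL1Idea2R4

namespace Reindex

/-- A re-indexing with steps `0/1` is monotone. [folklore] -/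
theorem mono {ψ : ℕ → ℕ} (hstep : ∀ m, ψ (m + 1) = ψ m ∨ ψ (m + 1) = ψ m + 1) {m m' : ℕ} (h : m ≤ m') :
    ψ m ≤ ψ m' := by
  induction h with
  | refl => exact le_rfl
  | @step m' _ ih =>
    have h1 := hstep m'
    show ψ m ≤ ψ (m' + 1)
    omega

/-- A re-indexing with steps `0/1` takes every value below any of its values (discrete intermediate values). [folklore] -/
theorem hits_below {ψ : ℕ → ℕ} (h0 : ψ 0 = 0) (hstep : ∀ m, ψ (m + 1) = ψ m ∨ ψ (m + 1) = ψ m + 1) :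
    ∀ m j, j ≤ ψ m → ∃ m', m' ≤ m ∧ ψ m' = j := by
  intro m
  induction m with
  | zero => intro j hj; exact ⟨0, le_rfl, by omega⟩
  | succ m ih =>
    intro j hj
    rcases hstep m with h1 | h1
    · obtain ⟨m', hm', e⟩ := ih j (by omega)
      exact ⟨m', by omega, e⟩
    · by_cases hjm : j ≤ ψ m
      · obtain ⟨m', hm', e⟩ := ih j hjm
        exact ⟨m', by omega, e⟩
      · exact ⟨m + 1, le_rfl, by omega⟩

/-- A re-indexing incremented infinitely often is unbounded. [folklore] -/
theorem unbounded {ψ : ℕ → ℕ} (hstep : ∀ m, ψ (m + 1) = ψ m ∨ ψ (m + 1) = ψ m + 1)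
    (hinc : ∀ n, ∃ m, n ≤ m ∧ ψ (m + 1) = ψ m + 1) : ∀ j, ∃ m, j ≤ ψ m := by
  intro j
  induction j with
  | zero => exact ⟨0, Nat.zero_le _⟩
  | succ j ih =>
    obtain ⟨m, hm⟩ := ih
    obtain ⟨m', hmm', hinc'⟩ := hinc m
    exact ⟨m' + 1, by have := mono hstep hmm'; omega⟩

/-- A re-indexing with `ψ 0 = 0`, steps `0/1`, incremented infinitely often, hits every value. [folklore] -/
theorem surjective {ψ : ℕ → ℕ} (h0 : ψ 0 = 0) (hstep : ∀ m, ψ (m + 1) = ψ m ∨ ψ (m + 1) = ψ m + 1)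
    (hinc : ∀ n, ∃ m, n ≤ m ∧ ψ (m + 1) = ψ m + 1) (j : ℕ) : ∃ m, ψ m = j := by
  obtain ⟨m, hm⟩ := unbounded hstep hinc j
  obtain ⟨m', -, e⟩ := hits_below h0 hstep m j hm
  exact ⟨m', e⟩

end Reindex

/-! ## §2. The restart from the simulation (S1) and res-type-071's origin data -/

/-- [OURS · L1 W4.2] **`IsoOpenRestartM OracleLocal p` FROM THE RUN-LEVEL ZARISKI LOCALISATION (S1).** At the reached ISOLATED
stage `c 0` of a moving E3 chain of the run of a maximal origin `(X, x)` under a functional admissible LOCAL oracle, res-type-071's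
`IsMaximalOrigin.exists_opens_pointed_of_iso` gives an open `U ∋ x_{c 0}` of `X_{c 0}` with `U(ν) = {x_{c 0}}` which is again a maximal
origin for `(p, 3, ν)`; (S1) `LocalRunSimulationM p` simulates the chain over `U` by the run of `(U, x_{c 0})`; grades transfer along the
open immersions (`Scheme.geomDirDim_eq_of_isOpenImmersion`), genuine steps by (S1)'s matching clause (so the simulated chain MOVES and its
re-indexing hits every index, §1), isolation by `Moving.Iso.of_isOpenImmersion_of_reaches`. Hence the moving E3 chain, isolated infinitely
often, continues as such a chain of the run of the POINTED origin `(U, x_{c 0})`. CONDITIONAL on (S1) (its proof is the multi-session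
object of record, res-L1-w42-plan-1 RULINGS v3.12-1 (A)). [cite: CossartJannsenSaito2020, Thm. 1.2 (p. 5), Rem. 6.29 (1)] -/
theorem isoOpenRestartM_oracleLocal_of_simulation (p : ℕ) (hsim : LocalRunSimulationM.{u} p) :
    IsoOpenRestartM.{u} OracleLocal.{u} p := by
  intro R hRf hRa hRl ν X _ x hX c h0 hstep hG hmov hiso0 hio
  -- the pointed open around the isolated marked point of `c 0` (res-type-071)
  obtain ⟨U, h₀, -, hUorig, hUpt⟩ := hX.exists_opens_pointed_of_iso hRa h0 hiso0
  haveI : IsLocallyNoetherian (c 0).W := (c 0).ln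
  haveI hUln : IsLocallyNoetherian (U : Scheme.{u}) := inferInstance
  -- the simulation (S1)
  obtain ⟨c', ψ, ι, hc'0, hψ0, hstep', hι, hψstep, hgen⟩ :=
    hsim R hRf hRa hRl ν X x hX c h0 hstep hmov U hUln h₀ hUpt
  have h0' : Reaches R 3 ν (@MarkedStage.init (U : Scheme.{u}) hUln ⟨(c 0).pt, h₀⟩) (c' 0) := by
    rw [hc'0]; exact Relation.ReflTransGen.refl
  have hinc : ∀ n, ∃ m, n ≤ m ∧ ψ (m + 1) = ψ m + 1 := fun n => by
    obtain ⟨m, hnm, hb⟩ := hmov n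
    exact ⟨m, hnm, (hgen m hb).1⟩
  have hsurj := Reindex.surjective hψ0 hψstep hinc
  refine ⟨U, hUln, ⟨(c 0).pt, h₀⟩, c', hUorig, hUpt, h0', hstep', fun j => ?_, fun j => ?_, fun j => ?_⟩
  · -- grades `3 ≤ ē` transfer along `ι m`
    obtain ⟨m, rfl⟩ := hsurj j
    obtain ⟨hιm, hιpt⟩ := hι m
    haveI := hιm
    haveI : IsLocallyNoetherian (c m).W := (c m).ln
    haveI : IsLocallyNoetherian (c' (ψ m)).W := (c' (ψ m)).ln
    have e := Scheme.geomDirDim_eq_of_isOpenImmersion (ι m) (c' (ψ m)).pt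
    rw [hιpt] at e
    have hGm := hG m
    unfold MarkedStage.geomDirDim at hGm ⊢
    rw [e]
    convert hGm
  · -- blown up infinitely often
    obtain ⟨m, rfl⟩ := hsurj j
    obtain ⟨m', hmm', hb⟩ := hmov m
    exact ⟨ψ m', Reindex.mono hψstep hmm', (hgen m' hb).2⟩
  · -- isolated infinitely often
    obtain ⟨m, rfl⟩ := hsurj j
    obtain ⟨m', hmm', hisom⟩ := hio m
    obtain ⟨hιm, hιpt⟩ := hι m'
    haveI := hιm
    exact ⟨ψ m', Reindex.mono hψstep hmm',
      Moving.Iso.of_isOpenImmersion_of_reaches hRa hX (reaches_chain h0 hstep m') (ι m') hιpt hisom⟩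

end Summit.ResolutionOfSingularities.ResolutionOfSingularities.Cruxes.SigmaMaxModifications.IdeasL1Idea2R4
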